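import Mathlib
import HarnessLib
import Literature.Computability.AlgebraicComplexity.PatternExpressions
import Summits.ValiantsHypothesis.ValiantsHypothesis.Theorems.MonotoneRestorationOrbitRestorationQPHomSpanTools

/-!
# Square-symmetric polynomials and DIRECTED homomorphism polynomials — tools

Route MonotoneRestoration; derived node `NonnegRestorationQP` (stmt-16191) / aside `OrbitCompressionQP`
(stmt-18332) / crux `OrbitRestorationQP` (stmt-18293).  The route's circuits are SQUARE-symmetric
(diagonal action of `Sym_n` on the `n × n` matrix, Dawar–Wilsenach `ORB`), while the pattern-expression
machinery of the tree (`PatternExpressions.lean`, K2/K3, ζ-P) is BIPARTITE (`Sym_n × Sym_n`).  Both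
Dawar–Pago–Seppelt 2025 (p. 17, Remark; p. 45) and Dwivedi–Pago–Seppelt 2026 (footnotes pp. 3–4) state
without proof that the square-symmetric polynomials are exactly the linear combinations of homomorphism
polynomials of DIRECTED LOOPED multigraphs, and develop their theory only in the bipartite setting.  This
file and its sequel `…DiHomSpan.lean` certify that statement (spanning direction), def-free: the directed
homomorphism polynomial of a pattern `E : Multiset (V × V)` is written out as
`Σ_{h : V → Fin n} Π_{(u,v) ∈ E} x_{h u, h v}`.

* `diOrbitSum_mapDomain` — the diagonal orbit sum `Σ_{σ ∈ Sym_n} x^{σ·D}` is constant on orbits;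
* `card_smul_eq_sum_diOrbitSum` — Reynolds: `n! · p = Σ_D coeff_D(p) · diOrbitSum D` for square-symmetric `p`;
* `diHom_eq_sum_monomial`, `rename_diHom`, `card_smul_diHom_eq_sum_diOrbitSum` — the directed homomorphism
  polynomial as a sum of monomials, its square symmetry, and its Reynolds identity;
* `diOrbitSum_push_eq_of_injective` — injective placements of one directed pattern share the orbit sum;
* `support_dipush_image` — the indices used by a pushed-forward exponent.
[cite: DawarPagoSeppelt2025, Remark p. 17 and §8 p. 45] [cite: DwivediPagoSeppelt2026, §1 (footnote)]
-/

noncomputable section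

open MvPolynomial

-- `Summit.ValiantsHypothesis.ValiantsHypothesis.…` is the tree's single-conjunct layout (Sub = Summit).
set_option linter.dupNamespace false

namespace Summit.ValiantsHypothesis.ValiantsHypothesis.Theorems

namespace DiHomSpan

open Literature.Computability.AlgebraicComplexity

variable {n : ℕ}

/-! ### Diagonal orbit sums -/

/-- Composition of the diagonal cell actions. [folklore] -/
theorem mapDomain_mapDomain_diag (D : (Fin n × Fin n) →₀ ℕ) (σ σ' : Equiv.Perm (Fin n)) :
    (D.mapDomain fun ij : Fin n × Fin n => (σ ij.1, σ ij.2)).mapDomain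
        (fun ij : Fin n × Fin n => (σ' ij.1, σ' ij.2)) =
      D.mapDomain fun ij : Fin n × Fin n => ((σ' * σ) ij.1, (σ' * σ) ij.2) := by
  rw [← Finsupp.mapDomain_comp]
  rfl

/-- **The diagonal orbit sum is constant on orbits.** [folklore] -/
theorem diOrbitSum_mapDomain (D : (Fin n × Fin n) →₀ ℕ) (σ : Equiv.Perm (Fin n)) :
    (∑ σ' : Equiv.Perm (Fin n),
        monomial ((D.mapDomain fun ij : Fin n × Fin n => (σ ij.1, σ ij.2)).mapDomain
          fun ij : Fin n × Fin n => (σ' ij.1, σ' ij.2)) (1 : ℂ)) =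
      ∑ σ' : Equiv.Perm (Fin n),
        monomial (D.mapDomain fun ij : Fin n × Fin n => (σ' ij.1, σ' ij.2)) (1 : ℂ) := by
  simp_rw [mapDomain_mapDomain_diag]
  exact Fintype.sum_equiv (Equiv.mulRight σ) _ _ fun σ' => rfl

/-- **Reynolds identity for a square-symmetric polynomial**: `n! · p = Σ_D coeff_D(p) · diOrbitSum D`.
[folklore] -/
theorem card_smul_eq_sum_diOrbitSum (p : MvPolynomial (Fin n × Fin n) ℂ)
    (hp : ∀ σ : Equiv.Perm (Fin n), rename (fun ij : Fin n × Fin n => (σ ij.1, σ ij.2)) p = p) :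
    (Fintype.card (Equiv.Perm (Fin n)) : ℂ) • p =
      ∑ D ∈ p.support, p.coeff D • ∑ σ : Equiv.Perm (Fin n),
        monomial (D.mapDomain fun ij : Fin n × Fin n => (σ ij.1, σ ij.2)) (1 : ℂ) := by
  have h1 : (Fintype.card (Equiv.Perm (Fin n)) : ℂ) • p =
      ∑ σ : Equiv.Perm (Fin n), rename (fun ij : Fin n × Fin n => (σ ij.1, σ ij.2)) p := by
    rw [Finset.sum_congr rfl fun σ _ => hp σ, Finset.sum_const, Finset.card_univ,
      ← Nat.cast_smul_eq_nsmul ℂ]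
  rw [h1]
  have h2 : ∀ σ : Equiv.Perm (Fin n), rename (fun ij : Fin n × Fin n => (σ ij.1, σ ij.2)) p =
      ∑ D ∈ p.support, p.coeff D •
        monomial (D.mapDomain fun ij : Fin n × Fin n => (σ ij.1, σ ij.2)) (1 : ℂ) := by
    intro σ
    conv_lhs => rw [p.as_sum]
    rw [map_sum]
    refine Finset.sum_congr rfl fun D _ => ?_
    rw [rename_monomial, smul_monomial, smul_eq_mul, mul_one]
  simp_rw [h2]
  rw [Finset.sum_comm]
  refine Finset.sum_congr rfl fun D _ => ?_
  rw [Finset.smul_sum]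

/-! ### Directed homomorphism polynomials (written out) -/

/-- **The directed homomorphism polynomial as a sum of monomials**:
`Σ_{h : V → [n]} Π_{(u,v) ∈ E} x_{h u, h v} = Σ_h x^{D_h}`. [folklore] -/
theorem diHom_eq_sum_monomial {V : Type} [Fintype V] [DecidableEq V] (E : Multiset (V × V)) (n : ℕ) :
    (∑ h : V → Fin n, (E.map fun e => (X (h e.1, h e.2) : MvPolynomial (Fin n × Fin n) ℂ)).prod) =
      ∑ h : V → Fin n, monomial (Multiset.toFinsupp (E.map fun e => (h e.1, h e.2))) (1 : ℂ) :=
  Finset.sum_congr rfl fun _ _ => HomExpansionUnique.prod_map_X_eq_monomial _ _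

/-- **Directed homomorphism polynomials are square-symmetric** (the diagonal renaming permutes the
vertex maps). [folklore] -/
theorem rename_diHom {V : Type} [Fintype V] [DecidableEq V] (E : Multiset (V × V)) (n : ℕ)
    (σ : Equiv.Perm (Fin n)) :
    rename (fun ij : Fin n × Fin n => (σ ij.1, σ ij.2))
      (∑ h : V → Fin n, (E.map fun e => (X (h e.1, h e.2) : MvPolynomial (Fin n × Fin n) ℂ)).prod) =
      ∑ h : V → Fin n, (E.map fun e => (X (h e.1, h e.2) : MvPolynomial (Fin n × Fin n) ℂ)).prod := by
  rw [map_sum]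
  simp only [map_multiset_prod, Multiset.map_map, Function.comp_def, rename_X]
  exact Fintype.sum_equiv ((Equiv.refl V).arrowCongr σ) _ _ fun h => rfl

/-- **Reynolds identity for a directed homomorphism polynomial**: `n! · dihom_E = Σ_h diOrbitSum D_h`.
[folklore] -/
theorem card_smul_diHom_eq_sum_diOrbitSum {V : Type} [Fintype V] [DecidableEq V]
    (E : Multiset (V × V)) (n : ℕ) :
    (Fintype.card (Equiv.Perm (Fin n)) : ℂ) •
        (∑ h : V → Fin n, (E.map fun e => (X (h e.1, h e.2) : MvPolynomial (Fin n × Fin n) ℂ)).prod) =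
      ∑ h : V → Fin n, ∑ σ : Equiv.Perm (Fin n),
        monomial ((Multiset.toFinsupp (E.map fun e => (h e.1, h e.2))).mapDomain
          fun ij : Fin n × Fin n => (σ ij.1, σ ij.2)) (1 : ℂ) := by
  have h1 : (Fintype.card (Equiv.Perm (Fin n)) : ℂ) •
      (∑ h : V → Fin n, (E.map fun e => (X (h e.1, h e.2) : MvPolynomial (Fin n × Fin n) ℂ)).prod) =
      ∑ σ : Equiv.Perm (Fin n), rename (fun ij : Fin n × Fin n => (σ ij.1, σ ij.2))
        (∑ h : V → Fin n, (E.map fun e => (X (h e.1, h e.2) : MvPolynomial (Fin n × Fin n) ℂ)).prod) := by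
    rw [Finset.sum_congr rfl fun σ _ => rename_diHom E n σ, Finset.sum_const, Finset.card_univ,
      ← Nat.cast_smul_eq_nsmul ℂ]
  rw [h1, Finset.sum_comm]
  refine Finset.sum_congr rfl fun σ _ => ?_
  rw [diHom_eq_sum_monomial, map_sum]
  refine Finset.sum_congr rfl fun h _ => ?_
  rw [rename_monomial]

/-! ### Injective placements -/

/-- **Injective placements of one directed pattern have the same diagonal orbit sum.** [folklore] -/
theorem diOrbitSum_push_eq_of_injective {V : Type} [Fintype V] [DecidableEq V] (E : Multiset (V × V))
    (h h' : V → Fin n) (hh : Function.Injective h) (hh' : Function.Injective h') :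
    (∑ σ : Equiv.Perm (Fin n),
        monomial ((Multiset.toFinsupp (E.map fun e => (h' e.1, h' e.2))).mapDomain
          fun ij : Fin n × Fin n => (σ ij.1, σ ij.2)) (1 : ℂ)) =
      ∑ σ : Equiv.Perm (Fin n),
        monomial ((Multiset.toFinsupp (E.map fun e => (h e.1, h e.2))).mapDomain
          fun ij : Fin n × Fin n => (σ ij.1, σ ij.2)) (1 : ℂ) := by
  classical
  obtain ⟨σ, hσ⟩ := HomSpan.exists_perm_comp_eq h h' hh hh'
  have key : Multiset.toFinsupp (E.map fun e => (h' e.1, h' e.2)) =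
      (Multiset.toFinsupp (E.map fun e => (h e.1, h e.2))).mapDomain
        fun ij : Fin n × Fin n => (σ ij.1, σ ij.2) := by
    rw [← HomSpan.toFinsupp_map, Multiset.map_map]
    congr 1
    refine Multiset.map_congr rfl fun e _ => ?_
    simp [hσ]
  rw [key, diOrbitSum_mapDomain]

/-! ### Indices used by a pushed-forward exponent -/

/-- The indices used (as a row or a column) by `D_h`, for a directed pattern WITHOUT ISOLATED VERTICES,
are the image of `h`. [folklore] -/
theorem support_dipush_image {V : Type} [Fintype V] [DecidableEq V] (E : Multiset (V × V))
    (hV : ∀ v, ∃ e ∈ E, e.1 = v ∨ e.2 = v) (h : V → Fin n) :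
    (Multiset.toFinsupp (E.map fun e => (h e.1, h e.2))).support.image Prod.fst ∪
        (Multiset.toFinsupp (E.map fun e => (h e.1, h e.2))).support.image Prod.snd =
      Finset.univ.image h := by
  classical
  ext i
  simp only [Finset.mem_union, Finset.mem_image, Multiset.toFinsupp_support, Multiset.mem_toFinset,
    Multiset.mem_map, Finset.mem_univ, true_and]
  constructor
  · rintro (⟨ij, ⟨e, -, rfl⟩, rfl⟩ | ⟨ij, ⟨e, -, rfl⟩, rfl⟩)
    · exact ⟨e.1, rfl⟩
    · exact ⟨e.2, rfl⟩
  · rintro ⟨v, rfl⟩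
    obtain ⟨e, he, hev | hev⟩ := hV v
    · exact Or.inl ⟨(h e.1, h e.2), ⟨e, he, rfl⟩, by rw [hev]⟩
    · exact Or.inr ⟨(h e.1, h e.2), ⟨e, he, rfl⟩, by rw [hev]⟩

/-- The number of edges of a pushed-forward exponent. [folklore] -/
theorem card_toMultiset_dipush {V : Type} [Fintype V] [DecidableEq V] (E : Multiset (V × V))
    (h : V → Fin n) :
    Multiset.card (Finsupp.toMultiset (Multiset.toFinsupp (E.map fun e => (h e.1, h e.2)))) =
      Multiset.card E := by
  rw [Multiset.toFinsupp_toMultiset, Multiset.card_map]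

end DiHomSpan

end Summit.ValiantsHypothesis.ValiantsHypothesis.Theorems

end
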